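import Mathlib
import Summits.Ventures.PercRepro2.TypedOProbe

/-!
# The probe kernel at the attachment `o ~ {a₁, b}` (blind cell PercRepro2, night-3 g16, 2026-08-27;
NIGHT3-CERT.md §25.7)

On the o-probe form `KBsym x y z = probeB x y z + probeB y x z + probeB z x y` (TypedOProbe.lean):

* `probeB_isolated`: a copy in which `o` is isolated (`Lo = Ho = false`) is never the probe —
  `probeB x y z = 0`;
* `probeB_lb`: if the probe copy `x` has `o` and `b` on the side of `a₁` (`Lo = Lb = true`,
  `Ho = Hb = false` — the copy in which `o` is attached to `a₁` and to `b`), then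
  `probeB x y z = P₁ + pdB x · (2 A + 2 crossB + 2 sameB)` with
  `P₁ = (qB x − pdB x)(1 − σ₃(x))[pdB y qB z (1 − σ_b(z)) + pdB z qB y (1 − σ_b(y))] ≥ 0` and
  `A = pdB y qB z 1_{bH}(y) + pdB z qB y 1_{bH}(z) ≥ 0` pointwise, `crossB` the state form of the
  cross-cluster kernel of `TwoCopyBHK.lean` for the pair `(b, a₃)` (`(bL(y) − bL(z))(3H(z) − 3H(y))`)
  and `sameB` the state form of the same-side kernel of `TypedSpectator.lean` for `(b, a₃)` on the
  side of `a₂` (`(bH(y) − bH(z))(3H(y) − 3H(z))`), both under `Q` in both copies.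

So the double-attachment class of `o ~ {a₁, b}` (`TypedTwoEdgesAtO.lean`) is, colouring by
colouring, a pointwise-nonnegative part plus `pdB x` times the two two-copy kernels whose
complementary-pair sums are the rows `CrossCount a₁ a₂ b a₃` and `SameCount a₂ a₁ b a₃`.
Polynomial identities in the state atoms (`ring` after the case split on the probe's bits). Own
work; standard axioms.
-/

namespace Summit.Ventures.PercRepro2

namespace CovForm

namespace OProbe

open OneTyped

/-- `1_{v ∈ C(a₂)}` as an integer. -/
def hB (H : Bool) : ℤ := if H then 1 else 0

/-- The state form of the cross-cluster kernel for the pair `(b, a₃)`: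
`1_Q(y) 1_Q(z) (1_{bL}(y) − 1_{bL}(z)) (1_{3H}(z) − 1_{3H}(y))`. -/
def crossB (y z : St) : ℤ :=
  qB y * qB z * ((hB y.Lb - hB z.Lb) * (hB z.H3 - hB y.H3))

/-- The state form of the same-side kernel for the pair `(b, a₃)` on the side of `a₂`:
`1_Q(y) 1_Q(z) (1_{bH}(y) − 1_{bH}(z)) (1_{3H}(y) − 1_{3H}(z))`. -/
def sameB (y z : St) : ℤ :=
  qB y * qB z * ((hB y.Hb - hB z.Hb) * (hB y.H3 - hB z.H3))

/-- The pointwise-nonnegative part of the probe at `o ~ {a₁, b}`. -/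
def lbP1 (x y z : St) : ℤ :=
  (qB x - pdB x) * (1 - sigB x.L3 x.H3) *
    (pdB y * qB z * (1 - sigB z.Lb z.Hb) + pdB z * qB y * (1 - sigB y.Lb y.Hb))

/-- The pointwise-nonnegative part of `Ψ`. -/
def lbA (y z : St) : ℤ := pdB y * qB z * hB y.Hb + pdB z * qB y * hB z.Hb

/-- A copy with `o` isolated is never the probe. -/
theorem probeB_isolated (x y z : St) (hx : x.Lo = false ∧ x.Ho = false) :
    probeB x y z = 0 := by
  obtain ⟨q, lo, ho, lb, hb, l3, h3⟩ := x
  simp only [St.Lo, St.Ho] at hx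
  obtain ⟨rfl, rfl⟩ := hx
  simp [probeB, phiB, sigB, uB, St.Lo, St.Ho]

/-- On a consistent state (`a₃` in both root clusters only when `Q` fails), `1_PD = 1_Q (1 − u₃)`. -/
lemma pdB_eq_of_consistent (y : St) (hy : y.L3 = true → y.H3 = true → y.q' = true) :
    pdB y = qB y * (1 - uB y.L3 y.H3) := by
  obtain ⟨q, lo, ho, lb, hb, l3, h3⟩ := y
  simp only [St.L3, St.H3, St.q'] at hy
  cases q <;> cases l3 <;> cases h3 <;> simp_all [pdB, qB, uB, St.q', St.L3, St.H3]

/-- `1_Q − 1_PD ≥ 0`. -/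
lemma qB_sub_pdB_nonneg (x : St) : 0 ≤ qB x - pdB x := by
  obtain ⟨q, lo, ho, lb, hb, l3, h3⟩ := x
  cases q <;> cases l3 <;> cases h3 <;> simp [pdB, qB, St.q', St.L3, St.H3]

/-- `1 − σ ≥ 0`. -/
lemma one_sub_sigB_nonneg (L H : Bool) : 0 ≤ 1 - sigB L H := by
  cases L <;> cases H <;> simp [sigB]

/-- `1_PD ≥ 0`. -/
lemma pdB_nonneg (x : St) : 0 ≤ pdB x := by
  unfold pdB; split_ifs <;> norm_num

/-- `1_Q ≥ 0`. -/
lemma qB_nonneg (x : St) : 0 ≤ qB x := by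
  unfold qB; split_ifs <;> norm_num

/-- `1_{bH} ≥ 0`. -/
lemma hB_nonneg (H : Bool) : 0 ≤ hB H := by
  unfold hB; split_ifs <;> norm_num

/-- **The probe at `o ~ {a₁, b}`**: with `o, b ∈ C(a₁)` in the probe copy and the two other copies
consistent (`a₃` in both root clusters only when `Q` fails),
`probeB x y z = P₁ + pdB x · (2 A + 2 crossB + 2 sameB)` — a polynomial identity in the state
atoms once `1_PD = 1_Q (1 − u₃)` is used in the two non-probe copies. -/
theorem probeB_lb (x y z : St) (hx : x.Lo = true ∧ x.Ho = false ∧ x.Lb = true ∧ x.Hb = false)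
    (hy : y.L3 = true → y.H3 = true → y.q' = true) (hz : z.L3 = true → z.H3 = true → z.q' = true) :
    probeB x y z = lbP1 x y z + pdB x * (2 * lbA y z + 2 * crossB y z + 2 * sameB y z) := by
  have hx3 : pdB x * sigB x.L3 x.H3 = 0 := by
    obtain ⟨q, lo, ho, lb, hb, l3, h3⟩ := x
    cases q <;> cases l3 <;> cases h3 <;> simp [pdB, sigB, St.q', St.L3, St.H3]
  have key : probeB x y z - (lbP1 x y z + pdB x * (2 * lbA y z + 2 * crossB y z + 2 * sameB y z)) =
      -(pdB y * qB z * (1 - sigB z.Lb z.Hb) + pdB z * qB y * (1 - sigB y.Lb y.Hb)) *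
        (pdB x * sigB x.L3 x.H3) := by
    unfold probeB phiB lbP1 lbA crossB sameB
    rw [pdB_eq_of_consistent y hy, pdB_eq_of_consistent z hz]
    obtain ⟨q, lo, ho, lb, hb, l3, h3⟩ := x
    simp only [St.Lo, St.Ho, St.Lb, St.Hb] at hx
    obtain ⟨rfl, rfl, rfl, rfl⟩ := hx
    simp only [St.Lo, St.Ho, St.Lb, St.Hb, St.L3, St.H3, sigB, uB, hB, if_true, if_false,
      Bool.false_eq_true]
    ring
  rw [hx3, mul_zero, sub_eq_zero] at key
  exact key

/-- `P₁ ≥ 0` pointwise. -/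
theorem lbP1_nonneg (x y z : St) : 0 ≤ lbP1 x y z := by
  unfold lbP1
  refine mul_nonneg (mul_nonneg (qB_sub_pdB_nonneg x) (one_sub_sigB_nonneg _ _)) ?_
  refine add_nonneg (mul_nonneg (mul_nonneg (pdB_nonneg y) (qB_nonneg z)) (one_sub_sigB_nonneg _ _))
    (mul_nonneg (mul_nonneg (pdB_nonneg z) (qB_nonneg y)) (one_sub_sigB_nonneg _ _))

/-- `A ≥ 0` pointwise. -/
theorem lbA_nonneg (y z : St) : 0 ≤ lbA y z := by
  unfold lbA
  exact add_nonneg (mul_nonneg (mul_nonneg (pdB_nonneg y) (qB_nonneg z)) (hB_nonneg _))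
    (mul_nonneg (mul_nonneg (pdB_nonneg z) (qB_nonneg y)) (hB_nonneg _))

end OProbe

end CovForm

end Summit.Ventures.PercRepro2
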